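import Literature.NumberTheory.EllipticCurves.ZpCorankStable
import Literature.NumberTheory.EllipticCurves.ZpCorankQuasiIso
import HarnessLib

/-!
# A lower bound for the `ℤ_p`-corank from the finite levels: subgroups of exponent `p^e` and order
# `≥ p^{e r}/C` for every `e` force `corank ≥ r`

Topic `Literature/NumberTheory/EllipticCurves`, family `bsd`. Pure group theory (theorems only, all proved, no
definition, no named fact) around the tree's corank formula
`Literature.NumberTheory.EllipticCurves.zpCorank A p = dim_{𝔽_p} A[p] - dim_{𝔽_p} A/pA` (files `Selmer`,
`SelmerCorankProofs`, `ZpCorankQuasiIso`, `ZpCorankStable`), supplying the COUNTING STEP of every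
«compact versus discrete» rank comparison (Greenberg, LNM 1716, §1: a cofinitely generated `p`-primary group is
`(ℚ_p/ℤ_p)^ρ ⊕ (finite)`, so it contains subgroups `≅ (ℤ/p^e)^r` of every level only if `r ≤ ρ`; Perrin-Riou 1987
§0 / Kato 2004 §14.1: `rank_{ℤ_p} S_p(E) = corank_{ℤ_p} Sel_{p^∞}(E)` is proved by mapping the finite levels
`S_p/p^e` into `Sel_{p^∞}[p^e]`).  As in `ZpCorankStable` the structure theorem is avoided.

* `natCard_torsionBy_pow_eq_pow_of_pDivisible` — for a `p`-DIVISIBLE group `D` with `D[p]` finite,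
  `#D[p^e] = (#D[p])^e` (induction along `0 → D[p] → D[p^{e+1}] →(p •) D[p^e] → 0`, surjective by divisibility).
* `le_zpCorank_of_forall_exists_addSubgroup` — **the bound**: let `A` be `p`-primary with `A[p]` finite; if for
  every `e` there is a subgroup `H_e ≤ A` killed by `p^e` with `p^{e·r} ≤ C · #H_e` (one constant `C`), then
  `r ≤ zpCorank A p`.  Proof: with `k` a stability index (`exists_torsionBy_inf_range_stable`), `D = p^k A` is
  `p`-divisible (`exists_nsmul_eq_of_stable`), `A/D` is finite, and `p^{zpCorank A p} = #(A[p] ∩ D)`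
  (`pow_zpCorank_eq_natCard_torsionBy_inf_range_of_stable`); now `H_e ∩ D ⊆ D[p^e]` has order `≤ p^{e·corank}` and
  index `≤ #(A/D)` in `H_e`, so `p^{e r} ≤ C · #(A/D) · p^{e·corank}` for every `e`, whence `r ≤ corank`.

References: R. Greenberg, *Iwasawa theory for elliptic curves*, LNM 1716 (1999), §1 (pp. 54–57) [Greenberg1999LNM];
B. Perrin-Riou, Bull. SMF 115 (1987) §0 (p. 401) [PerrinRiou1987BSMF]. Otherwise [folklore].
-/

noncomputable section

open scoped Classical AddSubgroup

namespace Literature.NumberTheory.EllipticCurves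

universe u

section Divisible

variable {D : Type u} [AddCommGroup D] (p : ℕ) [Fact p.Prime]

omit [Fact p.Prime] in
/-- **`#D[p^e] = (#D[p])^e` for a `p`-divisible group `D` with finite `D[p]`.**  Multiplication by `p` maps
`D[p^{e+1}]` onto `D[p^e]` (a `p`-th root of an element killed by `p^e` is killed by `p^{e+1}`) with kernel
`D[p]`.  Greenberg, LNM 1716, §1 (the `p^e`-torsion of the divisible group `(ℚ_p/ℤ_p)^ρ` is `(ℤ/p^e)^ρ`).
[cite: Greenberg1999LNM, §1 (pp. 54–57)] -/
theorem natCard_torsionBy_pow_eq_pow_of_pDivisible (hD : ∀ d : D, ∃ d' : D, p • d' = d)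
    [Finite D[(p : ℤ)]] (e : ℕ) :
    Nat.card D[((p ^ e : ℕ) : ℤ)] = Nat.card D[(p : ℤ)] ^ e := by
  induction e with
  | zero =>
    rw [pow_zero, pow_zero]
    haveI : Subsingleton D[((1 : ℕ) : ℤ)] := ⟨fun x y ↦ Subtype.ext (by
      have hx : (1 : ℕ) • (x : D) = 0 := AddSubgroup.torsionBy.nsmul_iff.mp x.2
      have hy : (1 : ℕ) • (y : D) = 0 := AddSubgroup.torsionBy.nsmul_iff.mp y.2
      rw [one_smul] at hx hy
      rw [hx, hy])⟩
    exact Nat.card_unique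
  | succ e ih =>
    haveI : Finite D[((p ^ (e + 1) : ℕ) : ℤ)] := finite_torsionBy_pow D p (e + 1)
    haveI : Finite D[((p ^ e : ℕ) : ℤ)] := finite_torsionBy_pow D p e
    -- multiplication by `p`: `D[p^{e+1}] → D[p^e]`
    let ψ : D[((p ^ (e + 1) : ℕ) : ℤ)] →+ D[((p ^ e : ℕ) : ℤ)] :=
      ((nsmulAddMonoidHom p).comp (D[((p ^ (e + 1) : ℕ) : ℤ)]).subtype).codRestrict _ fun x ↦
        AddSubgroup.torsionBy.nsmul_iff.mpr (by
          change p ^ e • p • (x : D) = 0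
          rw [smul_smul, ← pow_succ, ← AddSubgroupClass.coe_nsmul, AddSubgroup.torsionBy.nsmul x,
            ZeroMemClass.coe_zero])
    have hψ : ∀ x, ((ψ x : D[((p ^ e : ℕ) : ℤ)]) : D) = p • (x : D) := fun _ ↦ rfl
    -- `ψ` is onto: a `p`-th root of an element of `D[p^e]` lies in `D[p^{e+1}]`
    have hsurj : Function.Surjective ψ := by
      rintro ⟨y, hy⟩
      obtain ⟨x, hx⟩ := hD y
      refine ⟨⟨x, AddSubgroup.torsionBy.nsmul_iff.mpr ?_⟩, Subtype.ext (by rw [hψ, hx])⟩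
      rw [pow_succ, ← smul_smul, hx]
      exact AddSubgroup.torsionBy.nsmul_iff.mp hy
    -- its kernel is `D[p]`
    have hker : Nat.card ψ.ker = Nat.card D[(p : ℤ)] := by
      refine Nat.card_congr (Equiv.ofBijective
        (fun x : ψ.ker ↦ (⟨((x : D[((p ^ (e + 1) : ℕ) : ℤ)]) : D),
          AddSubgroup.torsionBy.nsmul_iff.mpr (by
            have h := congrArg (fun z : D[((p ^ e : ℕ) : ℤ)] ↦ (z : D)) (AddMonoidHom.mem_ker.mp x.2)
            rw [hψ] at h
            simpa using h)⟩ : D[(p : ℤ)])) ⟨?_, ?_⟩)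
      · intro x y hxy
        have h1 := congrArg (fun z : D[(p : ℤ)] ↦ (z : D)) hxy
        exact Subtype.ext (Subtype.ext (by simpa using h1))
      · rintro ⟨d, hd⟩
        have hd' : p • d = 0 := AddSubgroup.torsionBy.nsmul_iff.mp hd
        refine ⟨⟨⟨d, AddSubgroup.torsionBy.nsmul_iff.mpr ?_⟩, AddMonoidHom.mem_ker.mpr
          (Subtype.ext (by rw [hψ, hd']; rfl))⟩, rfl⟩
        rw [pow_succ, ← smul_smul, hd', smul_zero]
    have hrange : Nat.card ψ.range = Nat.card D[((p ^ e : ℕ) : ℤ)] := by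
      rw [AddMonoidHom.range_eq_top.mpr hsurj, AddSubgroup.card_top]
    rw [natCard_eq_card_ker_mul_card_range ψ, hker, hrange, ih, pow_succ, mul_comm]

end Divisible

section Bound

variable {A : Type u} [AddCommGroup A] (p : ℕ) [Fact p.Prime]

/-- **Lower bound for the corank from the finite levels.**  Let `A` be a `p`-primary group with `A[p]` finite,
and suppose that for every `e` there is a subgroup `H ≤ A` killed by `p^e` with `p^{e·r} ≤ C · #H`, for one
constant `C`.  Then `r ≤ zpCorank A p`.  (With `D = p^k A` at a stability index `k`: `D` is `p`-divisible,
`A/D` is finite, `p^{zpCorank A p} = #(A[p] ∩ D) = #D[p]`; the part of `H` inside `D` lies in `D[p^e]`, of order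
`(#D[p])^e`, and has index `≤ #(A/D)` in `H`.)  This is the counting step of «`rank_{ℤ_p} S_p(E) ≤
corank_{ℤ_p} Sel_{p^∞}(E)`» (Perrin-Riou 1987, §0: `S_p = lim← Sel^{(p^n)}` mapped into `Sel_{p^∞}`), for a
cofinitely generated `p`-primary group in Greenberg's sense.
[cite: Greenberg1999LNM, §1 (pp. 54–57)] [cite: PerrinRiou1987BSMF, §0 (p. 401)] -/
theorem le_zpCorank_of_forall_exists_addSubgroup (hA : ∀ a : A, ∃ n : ℕ, p ^ n • a = 0)
    [Finite A[(p : ℤ)]] {r C : ℕ}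
    (h : ∀ e : ℕ, ∃ H : AddSubgroup A, (∀ x ∈ H, p ^ e • x = 0) ∧ p ^ (e * r) ≤ C * Nat.card H) :
    r ≤ zpCorank A p := by
  have hp : p.Prime := Fact.out
  -- a stability index and the divisible subgroup `D = p^k A`
  obtain ⟨k, hst⟩ := exists_torsionBy_inf_range_stable (A := A) p
  set Dsub : AddSubgroup A := (nsmulAddMonoidHom (α := A) (p ^ k)).range with hDsub
  have hdiv : ∀ c ∈ Dsub, ∃ c' ∈ Dsub, p • c' = c := fun c hc ↦ by
    obtain ⟨n, hn⟩ := hA c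
    exact exists_nsmul_eq_of_stable p hst n c hc hn
  have hDd : ∀ d : Dsub, ∃ d' : Dsub, p • d' = d := fun d ↦ by
    obtain ⟨d', hd', hpd⟩ := hdiv d d.2
    exact ⟨⟨d', hd'⟩, Subtype.ext hpd⟩
  -- `p ^ zpCorank A p = #(A[p] ⊓ D)`
  have hcor := pow_zpCorank_eq_natCard_torsionBy_inf_range_of_stable (A := A) p hA hst
  -- `#(A[p] ⊓ D) = #D[p]` (for the group `↥D`)
  haveI hfinAD : Finite ↥(A[(p : ℤ)] ⊓ Dsub) :=
    Finite.of_injective (AddSubgroup.inclusion (inf_le_left : A[(p : ℤ)] ⊓ Dsub ≤ A[(p : ℤ)]))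
      (AddSubgroup.inclusion_injective _)
  have hDp : Nat.card (↥Dsub)[(p : ℤ)] = Nat.card ↥(A[(p : ℤ)] ⊓ Dsub) := by
    refine Nat.card_congr (Equiv.ofBijective
      (fun x : (↥Dsub)[(p : ℤ)] ↦ (⟨((x : Dsub) : A), AddSubgroup.mem_inf.mpr ⟨?_, (x : Dsub).2⟩⟩ :
        ↥(A[(p : ℤ)] ⊓ Dsub))) ⟨?_, ?_⟩)
    · rw [AddSubgroup.torsionBy.nsmul_iff, ← AddSubgroupClass.coe_nsmul,
        AddSubgroup.torsionBy.nsmul_iff.mp (x : (↥Dsub)[(p : ℤ)]).2, ZeroMemClass.coe_zero]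
    · intro x y hxy
      have h := congrArg Subtype.val hxy
      exact Subtype.ext (Subtype.ext h)
    · rintro ⟨a, ha⟩
      obtain ⟨ha₁, ha₂⟩ := AddSubgroup.mem_inf.mp ha
      refine ⟨⟨⟨a, ha₂⟩, AddSubgroup.torsionBy.nsmul_iff.mpr (Subtype.ext ?_)⟩, rfl⟩
      rw [AddSubgroupClass.coe_nsmul, ZeroMemClass.coe_zero]
      exact AddSubgroup.torsionBy.nsmul_iff.mp ha₁
  haveI : Finite (↥Dsub)[(p : ℤ)] :=
    Nat.finite_of_card_ne_zero (by rw [hDp]; exact Nat.card_pos.ne')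
  -- `A/D` is finite: `(A/D)[p]` is the image of `A[p]`, and `p^k (A/D) = 0`
  have hi : Function.Injective Dsub.subtype := Dsub.subtype_injective
  have hf : Function.Surjective (QuotientAddGroup.mk' Dsub) := QuotientAddGroup.mk'_surjective Dsub
  have hex : ∀ a, QuotientAddGroup.mk' Dsub a = 0 → a ∈ Dsub.subtype.range := fun a ha ↦ by
    rw [AddSubgroup.range_subtype]; exact (QuotientAddGroup.eq_zero_iff a).mp ha
  have hfi : ∀ d : Dsub, QuotientAddGroup.mk' Dsub (Dsub.subtype d) = 0 := fun d ↦
    (QuotientAddGroup.eq_zero_iff _).mpr d.2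
  haveI : Finite (A ⧸ Dsub)[(p : ℤ)] :=
    Finite.of_surjective _ (torsionByMap_surjective (p := p) hf hex hfi hDd)
  haveI hfinQ : Finite (A ⧸ Dsub) := by
    haveI := finite_torsionBy_pow (A ⧸ Dsub) p k
    refine Finite.of_injective (fun z : A ⧸ Dsub ↦ (⟨z, ?_⟩ : (A ⧸ Dsub)[((p ^ k : ℕ) : ℤ)]))
      (fun z w hzw ↦ congrArg Subtype.val hzw)
    induction z using QuotientAddGroup.induction_on with
    | H a =>
      rw [AddSubgroup.torsionBy.nsmul_iff, ← QuotientAddGroup.mk_nsmul, QuotientAddGroup.eq_zero_iff]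
      exact ⟨a, rfl⟩
  set f : ℕ := Nat.card (A ⧸ Dsub) with hfdef
  have hf0 : 0 < f := Nat.card_pos
  -- the key inequality at every level: `p^{e r} ≤ C * f * p^{e * zpCorank}`
  have key : ∀ e : ℕ, p ^ (e * r) ≤ C * f * p ^ (e * zpCorank A p) := by
    intro e
    obtain ⟨H, hHe, hHcard⟩ := h e
    haveI : Finite (↥Dsub)[((p ^ e : ℕ) : ℤ)] := finite_torsionBy_pow (↥Dsub) p e
    -- the map `H → A/D`
    let ψ : H →+ A ⧸ Dsub := (QuotientAddGroup.mk' Dsub).comp H.subtype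
    -- its kernel embeds in `D[p^e]`
    have hker : Nat.card ψ.ker ≤ Nat.card (↥Dsub)[((p ^ e : ℕ) : ℤ)] := by
      refine Nat.card_le_card_of_injective
        (fun x : ψ.ker ↦ (⟨⟨((x : H) : A), ?_⟩, ?_⟩ : (↥Dsub)[((p ^ e : ℕ) : ℤ)])) ?_
      · have hx : QuotientAddGroup.mk' Dsub ((x : H) : A) = 0 := AddMonoidHom.mem_ker.mp x.2
        exact (QuotientAddGroup.eq_zero_iff _).mp hx
      · rw [AddSubgroup.torsionBy.nsmul_iff]
        exact Subtype.ext (by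
          rw [AddSubgroupClass.coe_nsmul, ZeroMemClass.coe_zero]
          exact hHe _ (x : H).2)
      · intro x y hxy
        have h1 := congrArg (fun z : (↥Dsub)[((p ^ e : ℕ) : ℤ)] ↦ ((z : Dsub) : A)) hxy
        exact Subtype.ext (Subtype.ext h1)
    -- its image has order `≤ f`
    have hran : Nat.card ψ.range ≤ f :=
      Nat.card_le_card_of_injective (fun z : ψ.range ↦ (z : A ⧸ Dsub)) Subtype.val_injective
    have hH : Nat.card H ≤ f * Nat.card (↥Dsub)[((p ^ e : ℕ) : ℤ)] := by
      rw [natCard_eq_card_ker_mul_card_range ψ, mul_comm]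
      exact Nat.mul_le_mul hran hker
    rw [natCard_torsionBy_pow_eq_pow_of_pDivisible p hDd e, hDp, ← hcor, ← pow_mul,
      mul_comm (zpCorank A p) e] at hH
    calc p ^ (e * r) ≤ C * Nat.card H := hHcard
      _ ≤ C * (f * p ^ (e * zpCorank A p)) := Nat.mul_le_mul_left C hH
      _ = C * f * p ^ (e * zpCorank A p) := by rw [mul_assoc]
  -- conclusion: `r ≤ zpCorank A p`
  by_contra hlt
  push Not at hlt
  -- with `r ≥ zpCorank + 1`: `p^e ≤ C f` for every `e`
  have hCf : ∀ e : ℕ, p ^ e ≤ C * f := by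
    intro e
    have h1 := key e
    have hsplit : p ^ (e * r) = p ^ (e * zpCorank A p) * p ^ (e * (r - zpCorank A p)) := by
      rw [← pow_add, ← Nat.mul_add, Nat.add_sub_cancel' hlt.le]
    rw [hsplit] at h1
    have hpos : 0 < p ^ (e * zpCorank A p) := pow_pos hp.pos _
    have h2 : p ^ (e * (r - zpCorank A p)) ≤ C * f := by
      have h3 : p ^ (e * zpCorank A p) * p ^ (e * (r - zpCorank A p)) ≤
          p ^ (e * zpCorank A p) * (C * f) := by
        calc _ ≤ C * f * p ^ (e * zpCorank A p) := h1
          _ = p ^ (e * zpCorank A p) * (C * f) := by ring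
      exact Nat.le_of_mul_le_mul_left h3 hpos
    calc p ^ e = p ^ (e * 1) := by rw [mul_one]
      _ ≤ p ^ (e * (r - zpCorank A p)) :=
        Nat.pow_le_pow_right hp.pos (Nat.mul_le_mul_left e (by omega))
      _ ≤ C * f := h2
  have hlt2 : C * f < p ^ (C * f) :=
    lt_of_lt_of_le (Nat.lt_two_pow_self) (Nat.pow_le_pow_left hp.two_le _)
  exact absurd (hCf (C * f)) (not_le.mpr hlt2)

end Bound

end Literature.NumberTheory.EllipticCurves

end
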